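import Mathlib
import Summits.NavierStokesRegularity.NavierStokesRegularity.Theorems.EulerZoomLiouvillePowerGaugeEulerLiouvilleSelfSimilarEndpointMemberFull
import Summits.NavierStokesRegularity.NavierStokesRegularity.Theorems.EulerZoomLiouvillePowerGaugeEulerLiouvilleEnergySaturationMember
import Summits.NavierStokesRegularity.NavierStokesRegularity.Theorems.EulerZoomLiouvillePowerGaugeEulerLiouvilleSelfSimilarEndpointSobolevDecay
import HarnessLib

/-!
# Rung C1 of the crux `EulerZoomLiouville.PowerGaugeEulerLiouville` at the endpoint `ρ = 1/2` (weak class):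
# EVERY exactly-self-similar member drains at the rate `L^{−5/2+ε}`; shell energies `≥ c₀L^{−5+η}`,
# `η > 5/2`, along unbounded radii are fatal WITHOUT any growth hypothesis

Route №10 `EulerZoomLiouville` (NavierStokesRegularity), crux E = stmt-NavierStokesRegularity-19832,
registered open stub `stub_selfSimilarWeakRest`, whose binder `¬ (ρ = 1/2 ∧ IsPowerSpreadProfile V)`
records the filled endpoint stratum: POINTWISE sublinear growth `‖V(y)‖ ≤ C_up|y|^{1−δ}` a.e. far out AND
shell energies `≥ c₀ L^{−5+η}` (`η > 0`) along radii beyond every bound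
(`EndpointSpread.selfSimilar_half_ae_eq_zero_of_shellLower`, p615866; Chae–Shvydkoy 2013 Thm 3.1 in
Seregin's class).  The sublinear clause is used only to make the cubic flux and the near pressure linear
in the shell energy.  In Seregin's class the profile has a weak gradient with `∫ |G|²_F |y|^{−1/2} ≤ c/5`
(`EnergySaturation.profileData_of_selfSimilar`), and the local Sobolev inequality replaces the
pointwise bound (`…SobolevTools/Shell/Growth/Decay`), at the price of the drain rate (`5/2` for `5`):

* `EndpointSobolev.selfSimilar_half_shell_energy_decay` — **unconditional portrait**: crux hypotheses
  verbatim at `ρ = 1/2` + exact self-similarity about the origin ⇒ for every `ε > 0`,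
  `∫_{L≤|y|<2L} ‖V‖² ≤ C_ε L^{−5/2+ε}` for all `L ≥ 1` (hence `V ∈ L^p(ℝ³)` for `12/11 < p ≤ 2`; no
  profile-side hypothesis at all);
* `EndpointSobolev.selfSimilar_half_false_of_shellLower` / `…ae_eq_zero_of_shellLower` — plus
  `∃ c₀ η, 0 < c₀ ∧ 5/2 < η ∧ ∀ L₁ ∃ L ≥ L₁, c₀ L^{−5+η} ≤ ∫_{L≤|y|<2L}‖V‖²` ⇒ contradiction / the
  member vanishes a.e. — the SAME lower clause as `IsPowerSpreadProfile` with `5/2 < η` in place of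
  `0 < η` and NO sublinear clause (suggested wiring: `IsPowerSpreadProfile V :=
  (sublinear ∧ lower η>0) ∨ (lower η>5/2)`).

WHAT THIS IS NOT: not NS, not E, not the stub — one endpoint weak stratum widened; profiles drained
faster than `L^{−5/2}` with no pointwise growth control (e.g. locally rough, globally small tails) stay
in the registered residue. [cite: ChaeShvydkoy2013, §3.1 Thm. 3.1; BronziShvydkoy2015, Remark 1.5]
-/

noncomputable section

-- flat `Theorems/<Route><Decl>…` files of one crux share the namespace of the crux (tree convention)
set_option linter.dupNamespace false

open MeasureTheory Set Filter Topology Metric Function TopologicalSpace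
open scoped ENNReal NNReal InnerProductSpace RealInnerProductSpace

namespace Summit.NavierStokesRegularity.NavierStokesRegularity.Theorems.PowerGaugeEulerLiouville

open Literature.Analysis Literature.Analysis.FunctionSpaces Literature.Analysis.FluidPDE

namespace EndpointSobolev

section Member

/-- **Every endpoint member drains at the rate `L^{−5/2+ε}` (no growth hypothesis).**  Crux
hypotheses verbatim at `ρ = 1/2` (suitable weak Euler flow on `(−∞,0) × ℝ³`, weak gradient `H`,
Seregin's three gauges) + exact self-similarity about the origin with profile `(V, P)`: for every
`ε > 0` there is `C` with `∫_{L≤|y|<2L} ‖V‖² ≤ C L^{−5/2+ε}` for all `L ≥ 1`.  Every profile-side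
input is derived from the class: `V ∈ L² ∩ L³_loc`, `|P||V| ∈ L¹_loc`, the weak Poisson equation and
the Riesz representation of `P` at every scale (velocity growth from the WEAK GRADIENT,
`exists_setIntegral_cube_ball_le`), the profile local energy EQUALITY, and the weak gradient `G` with
`∫_{B_R}|G|²_F ≤ (c/5) R^{1/2}` (`EnergySaturation.profileData_of_selfSimilar` +
`EnergySaturation.lintegral_ball_frobenius_le_of_weight`); then
`shell_energy_decay_half_of_profileEE_of_weakGradient`.
[cite: ChaeShvydkoy2013, §3.1 proof of Thm. 3.1; BronziShvydkoy2015, Remark 1.5] -/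
theorem selfSimilar_half_shell_energy_decay
    {u : ℝ → EuclideanSpace ℝ (Fin 3) → EuclideanSpace ℝ (Fin 3)}
    {p : ℝ → EuclideanSpace ℝ (Fin 3) → ℝ}
    {H : ℝ → EuclideanSpace ℝ (Fin 3) → EuclideanSpace ℝ (Fin 3) →L[ℝ] EuclideanSpace ℝ (Fin 3)}
    {c : ℝ≥0} {V : EuclideanSpace ℝ (Fin 3) → EuclideanSpace ℝ (Fin 3)}
    {P : EuclideanSpace ℝ (Fin 3) → ℝ}
    (hsw : IsSuitableWeakSolutionOn (slab (EuclideanSpace ℝ (Fin 3)) (Iio 0) isOpen_Iio) 0 0 u p)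
    (hH : HasWeakSpatialGradientOn (slab (EuclideanSpace ℝ (Fin 3)) (Iio 0) isOpen_Iio) u H)
    (hgauge : ∀ a : ℝ, 0 < a →
      ENNReal.ofReal (a ^ (2 * (1 / 2 : ℝ))) * cknA a (0 : ℝ × EuclideanSpace ℝ (Fin 3)) u +
          ENNReal.ofReal (a ^ (1 / 2 : ℝ)) * cknE a (0 : ℝ × EuclideanSpace ℝ (Fin 3)) H +
        ENNReal.ofReal (a ^ (2 * (1 / 2 : ℝ))) * cknD a (0 : ℝ × EuclideanSpace ℝ (Fin 3)) p ≤
          (c : ℝ≥0∞))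
    (hu : ∀ τ : ℝ, τ < 0 → u τ = selfSimilarCollapse (1 / (2 + (1 / 2 : ℝ))) 0 V τ)
    (hp : ∀ τ : ℝ, τ < 0 → p τ = selfSimilarCollapsePressure (1 / (2 + (1 / 2 : ℝ))) 0 P τ)
    {ε : ℝ} (hε : 0 < ε) :
    ∃ C : ℝ, ∀ L : ℝ, 1 ≤ L →
      ∫ y in {y : EuclideanSpace ℝ (Fin 3) | L ≤ ‖y‖ ∧ ‖y‖ < 2 * L}, ‖V y‖ ^ 2 ≤
        C * L ^ (-(5 / 2 : ℝ) + ε) := by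
  -- adapted from `EndpointSpread.shell_energy_decay_of_sublinear` (…SelfSimilarEndpointShellSpread):
  -- the same derivations of the profile-side inputs, the sublinear bound replaced by the weak gradient
  have hA : ∀ a : ℝ, 0 < a → ENNReal.ofReal (a ^ (2 * (1 / 2 : ℝ))) *
      cknA a (0 : ℝ × EuclideanSpace ℝ (Fin 3)) u ≤ (c : ℝ≥0∞) :=
    fun a ha => le_trans (le_trans le_self_add le_self_add) (hgauge a ha)
  have hD : ∀ a : ℝ, 0 < a → ENNReal.ofReal (a ^ (2 * (1 / 2 : ℝ))) *
      cknD a (0 : ℝ × EuclideanSpace ℝ (Fin 3)) p ≤ (c : ℝ≥0∞) :=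
    fun a ha => le_trans le_add_self (hgauge a ha)
  have hum : AEStronglyMeasurable (uncurry u)
      (volume.restrict (Iio (0 : ℝ) ×ˢ (univ : Set (EuclideanSpace ℝ (Fin 3))))) := by
    have := hH.locallyIntegrableOn.aestronglyMeasurable
    simpa [slab] using this
  have hpm : AEStronglyMeasurable (uncurry p)
      (volume.restrict (Iio (0 : ℝ) ×ˢ (univ : Set (EuclideanSpace ℝ (Fin 3))))) := by
    have := hsw.distributional.2.2.1.aestronglyMeasurable
    simpa [slab] using this
  -- the profile dictionary of the class (weak gradient, `E`-weight, Poisson, energy equality)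
  obtain ⟨G, -, hVm, hPm, hGm, hW, -, hEw, -, hPoisson, hEE⟩ :=
    EnergySaturation.profileData_of_selfSimilar (ρ := 1 / 2) (by norm_num) (by norm_num) hsw hH
      hgauge hu hp
  -- `V ∈ L²` (endpoint `A`-gauge), `V ∈ L³_loc`
  have hV2 : Integrable (fun y => ‖V y‖ ^ 2) volume :=
    integrable_norm_sq_of_lintegral_lt_top hVm
      (lt_of_le_of_lt (lintegral_enorm_sq_profile_le_of_half hu hA) ENNReal.coe_lt_top)
  have hV3 : LocallyIntegrable (fun y => ‖V y‖ ^ 3) volume := locallyIntegrable_cube_profile hsw hum hu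
  -- `|P||V| ∈ L¹_loc` (weighted `D`-gauge bound)
  have hPw := profile_pressure_weight_of_gaugeD (ρ := 1 / 2) (by norm_num) (by norm_num) hpm hp hD
  have hBne : ENNReal.ofReal ((2 - 2 * (1 / 2 : ℝ)) / (2 + 1 / 2)) * (c : ℝ≥0∞) ≠ ⊤ :=
    ENNReal.mul_ne_top ENNReal.ofReal_ne_top ENNReal.coe_ne_top
  have hPV : LocallyIntegrable (fun y => |P y| * ‖V y‖) volume :=
    locallyIntegrable_abs_mul_norm_of_weight hPm hVm hV3 hBne hPw
  -- `P ∈ L¹_loc`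
  have hP1 : LocallyIntegrable P volume := by
    rw [locallyIntegrable_iff]
    intro K hK
    obtain ⟨r, hKr⟩ := hK.isBounded.subset_closedBall (0 : EuclideanSpace ℝ (Fin 3))
    have hr : 0 < |r| + 1 := by positivity
    haveI : IsFiniteMeasure (volume.restrict (ball (0 : EuclideanSpace ℝ (Fin 3)) (|r| + 1))) :=
      isFiniteMeasure_restrict.2 measure_ball_lt_top.ne
    have h32 : (1 : ℝ≥0∞) ≤ 3 / 2 := by
      rw [ENNReal.le_div_iff_mul_le (Or.inl two_ne_zero) (Or.inl ENNReal.ofNat_ne_top)]; norm_num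
    have hI : IntegrableOn P (ball (0 : EuclideanSpace ℝ (Fin 3)) (|r| + 1)) volume :=
      (memLp_threeHalves_ball_of_weight hPm hBne hPw hr).integrable h32
    exact hI.mono_set (hKr.trans (closedBall_subset_ball (by linarith [le_abs_self r])))
  -- the weak-gradient bound on balls: `∫_{B_R} |G|²_F ≤ (c/5) R^{1/2}`
  set C_G : ℝ := 1 / 5 * (c : ℝ) with hC_G
  have hCG : 0 ≤ C_G := by positivity
  have hGB : ∀ R : ℝ, 1 ≤ R →
      (∫⁻ y in ball (0 : EuclideanSpace ℝ (Fin 3)) R, ENNReal.ofReal (frobeniusNormSq (G y))) ≤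
        ENNReal.ofReal (C_G * R ^ (1 / 2 : ℝ)) := by
    intro R hR
    have hR0 : 0 < R := one_pos.trans_le hR
    have h := EnergySaturation.lintegral_ball_frobenius_le_of_weight (ρ := 1 / 2) (by norm_num) hEw hR0
    refine h.trans (le_of_eq ?_)
    rw [← ENNReal.ofReal_coe_nnreal, ← ENNReal.ofReal_mul (by norm_num),
      ← ENNReal.ofReal_mul (by positivity), hC_G]
    congr 1
    norm_num
    ring
  -- growth bounds with `σ = 4/3`: pressure from the `D`-weight, velocity from the weak gradient
  set AP : ℝ := (ENNReal.ofReal ((2 - 2 * (1 / 2 : ℝ)) / (2 + 1 / 2)) * (c : ℝ≥0∞)).toReal ^ (2 / 3 : ℝ) *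
    (volume.real (ball (0 : EuclideanSpace ℝ (Fin 3)) 1)) ^ (1 / 3 : ℝ) with hAP
  have hAP0 : 0 ≤ AP := by positivity
  obtain ⟨AV, hAV0, hVg0⟩ := exists_setIntegral_cube_ball_le hW hVm hGm hV2 hCG hGB
  have hPg : ∀ L : ℝ, 1 ≤ L → ∫ y in ball (0 : EuclideanSpace ℝ (Fin 3)) L, |P y| ≤
      max AP AV * L ^ (3 - (4 / 3 : ℝ)) := by
    intro L hL
    have h := setIntegral_abs_le_of_weight hPm hBne hPw hL
    rw [show (3 : ℝ) - 4 / 3 = 5 / 3 by norm_num]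
    exact h.trans (mul_le_mul_of_nonneg_right (le_max_left _ _) (by positivity))
  have hVg : ∀ L : ℝ, 1 ≤ L → ∫ y in ball (0 : EuclideanSpace ℝ (Fin 3)) L, ‖V y‖ ^ 3 ≤
      max AP AV * L ^ (3 - (4 / 3 : ℝ)) := fun L hL =>
    (hVg0 L hL).trans (mul_le_mul_of_nonneg_right (le_max_right _ _) (by positivity))
  -- the Riesz representation at every scale
  have hPR : ∀ R : ℝ, 1 ≤ R → ∀ᵐ y ∂volume, ‖y‖ < R / 2 →
      P y = rieszPressure ((ball (0 : EuclideanSpace ℝ (Fin 3)) R).indicator V) y +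
        ∫ z in {z | R ≤ ‖z‖}, pressureKernel (y - z) (V z) :=
    fun R hR => pressure_ae_eq_scaleQ_of_poisson hVm hV2 hV3 hP1 hPoisson (σ := 4 / 3)
      (by norm_num) (by norm_num) (le_max_of_le_left hAP0) hPg hVg (by linarith)
  exact shell_energy_decay_half_of_profileEE_of_weakGradient hVm hV2 hV3 hPV
    (by norm_num : (1 / (2 + (1 / 2 : ℝ)) : ℝ) = 2 / 5) hEE hPR hW hGm hCG hGB hε

/-- **No endpoint member whose shell energies are frequently `≥ c₀ L^{−5+η}` with `η > 5/2` — no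
growth hypothesis.**  Crux hypotheses verbatim at `ρ = 1/2`, exact self-similarity, and: for some
`c₀ > 0`, `η > 5/2` and radii `L` beyond every bound, `c₀ L^{−5+η} ≤ ∫_{L≤|y|<2L} ‖V‖²`.  Contradiction
with the growth-free drain at `ε = (η − 5/2)/2` (`selfSimilar_half_shell_energy_decay`): the lower
clause of `IsPowerSpreadProfile` with `5/2 < η`, the sublinear clause dropped.
[cite: ChaeShvydkoy2013, §3.1 Thm. 3.1] -/
theorem selfSimilar_half_false_of_shellLower
    {u : ℝ → EuclideanSpace ℝ (Fin 3) → EuclideanSpace ℝ (Fin 3)}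
    {p : ℝ → EuclideanSpace ℝ (Fin 3) → ℝ}
    {H : ℝ → EuclideanSpace ℝ (Fin 3) → EuclideanSpace ℝ (Fin 3) →L[ℝ] EuclideanSpace ℝ (Fin 3)}
    {c : ℝ≥0} {V : EuclideanSpace ℝ (Fin 3) → EuclideanSpace ℝ (Fin 3)}
    {P : EuclideanSpace ℝ (Fin 3) → ℝ}
    (hsw : IsSuitableWeakSolutionOn (slab (EuclideanSpace ℝ (Fin 3)) (Iio 0) isOpen_Iio) 0 0 u p)
    (hH : HasWeakSpatialGradientOn (slab (EuclideanSpace ℝ (Fin 3)) (Iio 0) isOpen_Iio) u H)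
    (hgauge : ∀ a : ℝ, 0 < a →
      ENNReal.ofReal (a ^ (2 * (1 / 2 : ℝ))) * cknA a (0 : ℝ × EuclideanSpace ℝ (Fin 3)) u +
          ENNReal.ofReal (a ^ (1 / 2 : ℝ)) * cknE a (0 : ℝ × EuclideanSpace ℝ (Fin 3)) H +
        ENNReal.ofReal (a ^ (2 * (1 / 2 : ℝ))) * cknD a (0 : ℝ × EuclideanSpace ℝ (Fin 3)) p ≤
          (c : ℝ≥0∞))
    (hu : ∀ τ : ℝ, τ < 0 → u τ = selfSimilarCollapse (1 / (2 + (1 / 2 : ℝ))) 0 V τ)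
    (hp : ∀ τ : ℝ, τ < 0 → p τ = selfSimilarCollapsePressure (1 / (2 + (1 / 2 : ℝ))) 0 P τ)
    {c₀ η : ℝ} (hc₀ : 0 < c₀) (hη : 5 / 2 < η)
    (hlow : ∀ L₁ : ℝ, ∃ L : ℝ, L₁ ≤ L ∧
      c₀ * L ^ (-(5 : ℝ) + η) ≤
        ∫ y in {y : EuclideanSpace ℝ (Fin 3) | L ≤ ‖y‖ ∧ ‖y‖ < 2 * L}, ‖V y‖ ^ 2) : False := by
  -- adapted from `EndpointSpread.selfSimilar_half_false_of_shellLower` (rate 5/2 for 5)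
  have hη' : 0 < η - 5 / 2 := by linarith
  obtain ⟨C, hC⟩ := selfSimilar_half_shell_energy_decay hsw hH hgauge hu hp (half_pos hη')
  have hkey : ∀ L : ℝ, 1 ≤ L →
      c₀ * L ^ (-(5 : ℝ) + η) ≤
        ∫ y in {y : EuclideanSpace ℝ (Fin 3) | L ≤ ‖y‖ ∧ ‖y‖ < 2 * L}, ‖V y‖ ^ 2 →
      c₀ * L ^ ((η - 5 / 2) / 2) ≤ C := by
    intro L hL1 hL
    have hL0 : 0 < L := one_pos.trans_le hL1
    have h1 : c₀ * L ^ (-(5 : ℝ) + η) ≤ C * L ^ (-(5 / 2 : ℝ) + (η - 5 / 2) / 2) :=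
      hL.trans (hC L hL1)
    have h2 := mul_le_mul_of_nonneg_right h1
      (Real.rpow_pos_of_pos hL0 (5 / 2 - (η - 5 / 2) / 2)).le
    have e1 : c₀ * L ^ (-(5 : ℝ) + η) * L ^ (5 / 2 - (η - 5 / 2) / 2) =
        c₀ * L ^ ((η - 5 / 2) / 2) := by
      rw [mul_assoc, ← Real.rpow_add hL0]; ring_nf
    have e2 : C * L ^ (-(5 / 2 : ℝ) + (η - 5 / 2) / 2) * L ^ (5 / 2 - (η - 5 / 2) / 2) = C := by
      rw [mul_assoc, ← Real.rpow_add hL0,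
        show -(5 / 2 : ℝ) + (η - 5 / 2) / 2 + (5 / 2 - (η - 5 / 2) / 2) = 0 by ring,
        Real.rpow_zero, mul_one]
    rwa [e1, e2] at h2
  have hev : ∀ᶠ L : ℝ in atTop, C / c₀ < L ^ ((η - 5 / 2) / 2) :=
    (tendsto_rpow_atTop (half_pos hη')).eventually_gt_atTop (C / c₀)
  obtain ⟨L₁, hL₁⟩ := (hev.and (eventually_ge_atTop (1 : ℝ))).exists_forall_of_atTop
  obtain ⟨L, hLL₁, hL⟩ := hlow L₁
  have h := hkey L (hL₁ L hLL₁).2 hL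
  have h' := (hL₁ L hLL₁).1
  rw [div_lt_iff₀ hc₀] at h'
  linarith [mul_comm c₀ (L ^ ((η - 5 / 2) / 2))]

/-- **The growth-free shell-lower stratum of rung C1 at the endpoint, `Sig`-shaped**: an exactly
self-similar member of the class at `ρ = 1/2` whose dyadic shell energies are `≥ c₀ L^{−5+η}`, `η > 5/2`,
along radii beyond every bound vanishes a.e. (vacuously) — no sublinear clause.
[cite: ChaeShvydkoy2013, §3.1 Thm. 3.1] -/
theorem selfSimilar_half_ae_eq_zero_of_shellLower
    {u : ℝ → EuclideanSpace ℝ (Fin 3) → EuclideanSpace ℝ (Fin 3)}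
    {p : ℝ → EuclideanSpace ℝ (Fin 3) → ℝ}
    {H : ℝ → EuclideanSpace ℝ (Fin 3) → EuclideanSpace ℝ (Fin 3) →L[ℝ] EuclideanSpace ℝ (Fin 3)}
    {c : ℝ≥0} {V : EuclideanSpace ℝ (Fin 3) → EuclideanSpace ℝ (Fin 3)}
    {P : EuclideanSpace ℝ (Fin 3) → ℝ}
    (hsw : IsSuitableWeakSolutionOn (slab (EuclideanSpace ℝ (Fin 3)) (Iio 0) isOpen_Iio) 0 0 u p)
    (hH : HasWeakSpatialGradientOn (slab (EuclideanSpace ℝ (Fin 3)) (Iio 0) isOpen_Iio) u H)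
    (hgauge : ∀ a : ℝ, 0 < a →
      ENNReal.ofReal (a ^ (2 * (1 / 2 : ℝ))) * cknA a (0 : ℝ × EuclideanSpace ℝ (Fin 3)) u +
          ENNReal.ofReal (a ^ (1 / 2 : ℝ)) * cknE a (0 : ℝ × EuclideanSpace ℝ (Fin 3)) H +
        ENNReal.ofReal (a ^ (2 * (1 / 2 : ℝ))) * cknD a (0 : ℝ × EuclideanSpace ℝ (Fin 3)) p ≤
          (c : ℝ≥0∞))
    (hu : ∀ τ : ℝ, τ < 0 → u τ = selfSimilarCollapse (1 / (2 + (1 / 2 : ℝ))) 0 V τ)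
    (hp : ∀ τ : ℝ, τ < 0 → p τ = selfSimilarCollapsePressure (1 / (2 + (1 / 2 : ℝ))) 0 P τ)
    {c₀ η : ℝ} (hc₀ : 0 < c₀) (hη : 5 / 2 < η)
    (hlow : ∀ L₁ : ℝ, ∃ L : ℝ, L₁ ≤ L ∧
      c₀ * L ^ (-(5 : ℝ) + η) ≤
        ∫ y in {y : EuclideanSpace ℝ (Fin 3) | L ≤ ‖y‖ ∧ ‖y‖ < 2 * L}, ‖V y‖ ^ 2) :
    uncurry u =ᵐ[volume.restrict (Iio (0 : ℝ) ×ˢ (univ : Set (EuclideanSpace ℝ (Fin 3))))] 0 :=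
  (selfSimilar_half_false_of_shellLower hsw hH hgauge hu hp hc₀ hη hlow).elim

end Member

end EndpointSobolev

end Summit.NavierStokesRegularity.NavierStokesRegularity.Theorems.PowerGaugeEulerLiouville
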